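import Literature.AlgebraicGeometry.AbelianVarieties.MarkmanUntwist
import Literature.AlgebraicGeometry.AbelianVarieties.MarkmanKernelDescentIdentity
import Literature.AlgebraicGeometry.Motives.AbelianVarietyIsogenyFactorisationPoints
import HarnessLib

/-!
# Markman's quotient square: `Ker (q × 1_A)(ℂ)`, the factorisation `π″ ≫ ε = (π₁ × π₂) × 1_Â`, and the kernel descent
# `π″^*(ε^*𝒩₀) ≅ 𝒩 ⊗ g′^*D′_s` along the cartesian square

Layer `Literature/AlgebraicGeometry/AbelianVarieties`; sequel to `MarkmanUntwist` (`Ω`, `χ`, `π″ = Ω ≫ (q × 1_A)`, the cartesian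
square `(g′, π″; q, pr_Y)`) and `MarkmanKernelDescentIdentity` (`π′^*𝒩₀ ≅ 𝒩 ⊗ g′^*D′_s`, `π′ : (A × A) × Â → (A/G₁ × A/G₂) × Â`).

* §1 **`Ker (q × 1_A)(ℂ) ≤ Ker (Ω⁻¹ ≫ π′)(ℂ)`** (`kerPoints_prodMap_secantQuotientMap_le`): a complex point `((c, γ), 1)` with
  `q(c, γ) = 1` has `(c, γ) = σ(x₁, x₂)`, `xᵢ ∈ Gᵢ` (`Ker q(ℂ) = Ḡ`), `χ(σ(x₁, x₂)) = x₁ⁿ x₂⁻¹ = x₂⁻¹` (`Gᵢ ≤ A[n]`, `n = 2j+1`),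
  so `Ω⁻¹((c, γ), 1) = (x₁, x₂, 1)`, killed by `π′`; hence the homomorphism **`ε : Y × A → (A/G₁ × A/G₂) × Â`** (`descentFactor`,
  `IsIsogeny.exists_comp_eq_of_kerPoints_le_points` for the isogeny `q × 1_A`) with **`π″ ≫ ε = π′`**
  (`quotientProductHom_comp_descentFactor`, and on schemes `toSchemeHom_quotientProductHom_comp_descentFactor`);
* §2 the TRANSPORTED KERNEL DESCENT **`π″^*(ε^*𝒩₀) ≅ 𝒩 ⊗ g′^*D′_s`** (`nonempty_pullback_quotientProduct_markmanKernel_iso`).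

Cyclicity of `Gᵢ` and `G₁ ∩ G₂ = 0` are not used. Everything PROVED; 0 named facts; no instance, no notation. A research route
conditional on HC_CM, not a corollary — nothing here refers to it.

## References

* E. Markman, arXiv:2502.03415 (2025), §9.3 Lemma 9.3.3, Remark 9.3.7 (pp. 71–73). [Markman2025SecantWeil]
* D. Mumford, *Abelian Varieties* (1970), §7 Thm. 4 (p. 72), §19, §23. [MumfordAV1970]
* J. S. Milne, *Abelian Varieties* (2008), I §8 Rem. 8.12 (universal property of isogenies). [MilneAV2008]
-/

noncomputable section

-- `TopCat.Presheaf`/`Scheme.Modules` are not reducible (as in Mathlib's `AlgebraicGeometry/Modules/Sheaf.lean`).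
set_option backward.isDefEq.respectTransparency false

open CategoryTheory CategoryTheory.Limits AlgebraicGeometry MonoidalCategory CartesianMonoidalCategory
open AlgebraicGeometry.Scheme.Modules

namespace Literature.AlgebraicGeometry.AbelianVarieties

open Literature.AlgebraicGeometry.Motives Literature.AlgebraicGeometry.Modules Literature.AlgebraicGeometry.Markman2025
open scoped MonObj

variable (A : AbelianVariety ℂ) {Θ : CartierDivisor A.X.left} (hΘ : Θ.IsAmple)

/-! ### §1 The complex points of `Ker (q × 1_A)` and the factorisation `π″ ≫ ε = π′` -/

section Factor

variable (hK : A.KTheta Θ = ⊥) {n : ℕ} (hn : n ≠ 0) (G₁ G₂ : Subgroup (A.Points ℂ))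
  (hG₁ : G₁ ≤ A.torsionPoints ℂ n) (hG₂ : G₂ ≤ A.torsionPoints ℂ n)

omit hΘ in
/-- Underlying morphism of a composite (`rfl`). [cite: MumfordAV1970, §19] -/
private theorem comp_hhh {X Y Z : AbelianVariety ℂ} (f : X ⟶ Y) (g : Y ⟶ Z) :
    (f ≫ g).hom.hom.hom = f.hom.hom.hom ≫ g.hom.hom.hom := rfl

omit hΘ in
/-- Underlying morphism of a sum: the product of `T`-points (`rfl`). [cite: MumfordAV1970, §19] -/
private theorem add_hhh {X Y : AbelianVariety ℂ} (f g : X ⟶ Y) : (f + g).hom.hom.hom = f.hom.hom.hom * g.hom.hom.hom := rfl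

omit hΘ in
/-- Underlying morphism of a difference. [cite: MumfordAV1970, §19] -/
private theorem sub_hhh {X Y : AbelianVariety ℂ} (f g : X ⟶ Y) : (f - g).hom.hom.hom = f.hom.hom.hom * (g.hom.hom.hom)⁻¹ := by
  rw [sub_eq_add_neg]
  rfl

omit hΘ in
/-- Underlying morphism of a multiple. [cite: MumfordAV1970, §19] -/
private theorem nsmul_hhh {X Y : AbelianVariety ℂ} (m : ℕ) (f : X ⟶ Y) : (m • f).hom.hom.hom = f.hom.hom.hom ^ m := by
  change (f.hom ^ m).hom.hom = _
  rw [Grp.Hom.hom_pow, Mon.Hom.hom_pow]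

omit hΘ in
/-- Underlying morphism of `pr₁` (`rfl`). [cite: MumfordAV1970, §19] -/
private theorem fst_hhh (X Y : AbelianVariety ℂ) : (AbelianVariety.fst X Y).hom.hom.hom = fst X.X Y.X := rfl

omit hΘ in
/-- Underlying morphism of `pr₂` (`rfl`). [cite: MumfordAV1970, §19] -/
private theorem snd_hhh (X Y : AbelianVariety ℂ) : (AbelianVariety.snd X Y).hom.hom.hom = snd X.X Y.X := rfl

omit hΘ in
/-- A point of a product with both components trivial is trivial. [cite: MumfordAV1970, §19 (homomorphisms into products)] -/
private theorem eq_one_of_comp_fst_snd {T : SchemeOver ℂ} {X Y : AbelianVariety ℂ} (x : T ⟶ (X.prod Y).X)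
    (h₁ : x ≫ (AbelianVariety.fst X Y).hom.hom.hom = 1) (h₂ : x ≫ (AbelianVariety.snd X Y).hom.hom.hom = 1) : x = 1 :=
  CartesianMonoidalCategory.hom_ext _ _ (by rw [MonObj.one_comp]; exact h₁) (by rw [MonObj.one_comp]; exact h₂)

/-- The underlying morphism of `χ`: `χ = pr_A^{j+1} · (pr_Â ≫ φ_Θ⁻¹)^{j}` (multiplicatively). [cite: MumfordAV1970, §19] -/
theorem untwistChar_hom (j : ℕ) :
    (untwistChar A hΘ hK j).hom.hom.hom =
      (AbelianVariety.fst A (A.dualOf Θ hΘ)).hom.hom.hom ^ (j + 1) *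
        ((AbelianVariety.snd A (A.dualOf Θ hΘ)).hom.hom.hom ≫ phiThetaInv A hΘ hK) ^ j := by
  rw [untwistChar, add_hhh, nsmul_hhh, nsmul_hhh, comp_hhh]

include hG₁ in
/-- **`χ(σ(x₁, x₂)) = x₂⁻¹` for `x₁ ∈ G₁ ≤ A[n]`, `n = 2j+1`.** [cite: Markman2025SecantWeil, §9.3 Lemma 9.3.3 (p. 71: Ḡ)] -/
theorem rouquierShear_comp_untwistChar {j : ℕ} (hj : 2 * j + 1 = n) {x₁ : A.Points ℂ} (hx₁ : x₁ ∈ G₁) (x₂ : A.Points ℂ) :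
    (rouquierShear A hΘ (x₁, x₂) : (A.prod (A.dualOf Θ hΘ)).Points ℂ) ≫ (untwistChar A hΘ hK j).hom.hom.hom = x₂⁻¹ := by
  have hn₁ : x₁ ^ n = 1 := by
    have h := (AbelianVariety.mem_torsionPoints_iff (n : ℤ) x₁).1 (hG₁ hx₁)
    rwa [zpow_natCast] at h
  have h₂ : (rouquierShear A hΘ (x₁, x₂) : (A.prod (A.dualOf Θ hΘ)).Points ℂ) ≫
      (AbelianVariety.snd A (A.dualOf Θ hΘ)).hom.hom.hom ≫ phiThetaInv A hΘ hK = x₁ * x₂ := by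
    rw [← Category.assoc, rouquierShear_comp_snd]
    change ((x₁ * x₂) ≫ (A.phiTheta Θ hΘ).hom.hom.hom) ≫ phiThetaInv A hΘ hK = _
    rw [Category.assoc, phiTheta_comp_phiThetaInv, Category.comp_id]
  rw [untwistChar_hom, MonObj.comp_mul, MonObj.comp_pow, MonObj.comp_pow, rouquierShear_comp_fst, h₂]
  -- `(x₁x₂⁻¹)^{j+1} (x₁x₂)^j = x₁^{2j+1} x₂⁻¹ = x₂⁻¹`
  have key : (x₁ * x₂⁻¹) ^ (j + 1) * (x₁ * x₂) ^ j = x₁ ^ (2 * j + 1) * x₂⁻¹ := by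
    apply Additive.ofMul.injective
    simp only [ofMul_mul, ofMul_pow, ofMul_inv, smul_add, smul_neg, add_nsmul, one_nsmul, mul_nsmul', two_nsmul]
    abel
  rw [key, hj, hn₁, one_mul]

/-- **`Ker (q × 1_A)(ℂ) ≤ Ker (Ω⁻¹ ≫ π′)(ℂ)`**, `π′ = (π₁ × π₂) × 1_Â`: a complex point `((c, γ), b′)` with `q(c, γ) = 1`, `b′ = 1`
has `(c, γ) = σ(x₁, x₂)` with `xᵢ ∈ Gᵢ` (`Ker q(ℂ) = Ḡ`), and then `Ω⁻¹((c, γ), 1) = (x₁, x₂, 1)` (`χ(σ(x)) = x₂⁻¹`), which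
`π′` kills. [cite: Markman2025SecantWeil, §9.3 Lemma 9.3.3 and Remark 9.3.7 (pp. 71–73)] [cite: MilneAV2008, I §8 Rem. 8.12] -/
theorem kerPoints_prodMap_secantQuotientMap_le {j : ℕ} (hj : 2 * j + 1 = n) :
    AbelianVariety.Hom.kerPoints (specOver ℂ ℂ)
        (AbelianVariety.prodMap (secantQuotientMap A hΘ G₁ G₂ hn hG₁ hG₂) (𝟙 A)) ≤
      AbelianVariety.Hom.kerPoints (specOver ℂ ℂ)
        (untwistInv A hΘ hK j ≫ AbelianVariety.prodMap
          (AbelianVariety.prodMap (A.torsionQuotHom hn G₁ hG₁) (A.torsionQuotHom hn G₂ hG₂)) (𝟙 (A.dualOf Θ hΘ))) := by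
  intro P hP
  rw [AbelianVariety.Hom.mem_kerPoints_iff] at hP ⊢
  -- the two components of `hP`: `q(p) = 1`, `b′ = 1`
  have hq : (P ≫ (AbelianVariety.fst (A.prod (A.dualOf Θ hΘ)) A).hom.hom.hom) ≫
      (secantQuotientMap A hΘ G₁ G₂ hn hG₁ hG₂).hom.hom.hom = 1 := by
    have h := congrArg (· ≫ (AbelianVariety.fst (secantQuotient A hΘ G₁ G₂ hn hG₁ hG₂) A).hom.hom.hom) hP
    simp only [Category.assoc, MonObj.one_comp, ← comp_hhh, AbelianVariety.prodMap_fst] at h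
    rwa [comp_hhh] at h
  have hb : P ≫ (AbelianVariety.snd (A.prod (A.dualOf Θ hΘ)) A).hom.hom.hom = 1 := by
    have h := congrArg (· ≫ (AbelianVariety.snd (secantQuotient A hΘ G₁ G₂ hn hG₁ hG₂) A).hom.hom.hom) hP
    simp only [Category.assoc, MonObj.one_comp, ← comp_hhh, AbelianVariety.prodMap_snd, Category.comp_id] at h
    exact h
  have hmem : P ≫ (AbelianVariety.fst (A.prod (A.dualOf Θ hΘ)) A).hom.hom.hom ∈ rouquierImage A hΘ G₁ G₂ := by
    rw [← ker_monoidHom_secantQuotientMap (hn := hn) (h₁ := hG₁) (h₂ := hG₂)]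
    exact hq
  obtain ⟨x₁, hx₁, x₂, hx₂, hx⟩ := (mem_rouquierImage_iff _).1 hmem
  -- the coordinates `c`, `γ`, `χ(c, γ)`, `b = b′ − χ(c, γ)` at `P`
  have hcW : P ≫ (AbelianVariety.fst (A.prod (A.dualOf Θ hΘ)) A ≫ AbelianVariety.fst A (A.dualOf Θ hΘ)).hom.hom.hom =
      x₁ * x₂⁻¹ := by
    rw [comp_hhh, ← Category.assoc, ← hx, rouquierShear_comp_fst]
  have hγW : P ≫ (AbelianVariety.fst (A.prod (A.dualOf Θ hΘ)) A ≫ AbelianVariety.snd A (A.dualOf Θ hΘ)).hom.hom.hom =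
      (x₁ * x₂) ≫ (A.phiTheta Θ hΘ).hom.hom.hom := by
    rw [comp_hhh, ← Category.assoc, ← hx, rouquierShear_comp_snd]
    rfl
  have hχ : P ≫ (AbelianVariety.fst (A.prod (A.dualOf Θ hΘ)) A ≫ untwistChar A hΘ hK j).hom.hom.hom = x₂⁻¹ := by
    rw [comp_hhh, ← Category.assoc, ← hx, rouquierShear_comp_untwistChar A hΘ hK G₁ hG₁ hj hx₁ x₂]
  have hbW : P ≫ (AbelianVariety.snd (A.prod (A.dualOf Θ hΘ)) A -
      AbelianVariety.fst (A.prod (A.dualOf Θ hΘ)) A ≫ untwistChar A hΘ hK j).hom.hom.hom = x₂ := by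
    rw [sub_hhh, MonObj.comp_mul, GrpObj.comp_inv, hb, hχ, inv_inv, one_mul]
  -- the three coordinates of `Ω⁻¹(P)`: `x₁`, `x₂`, `1`
  have ha : P ≫ (untwistInv A hΘ hK j ≫ AbelianVariety.fst _ _ ≫ AbelianVariety.fst A A).hom.hom.hom = x₁ := by
    rw [untwistInv, AbelianVariety.prodLift_fst_assoc, AbelianVariety.prodLift_fst, add_hhh, MonObj.comp_mul, hcW, hbW,
      inv_mul_cancel_right]
  have hb₂ : P ≫ (untwistInv A hΘ hK j ≫ AbelianVariety.fst _ _ ≫ AbelianVariety.snd A A).hom.hom.hom = x₂ := by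
    rw [untwistInv, AbelianVariety.prodLift_fst_assoc, AbelianVariety.prodLift_snd, hbW]
  have hβ : P ≫ (untwistInv A hΘ hK j ≫ AbelianVariety.snd _ _).hom.hom.hom = 1 := by
    rw [untwistInv, AbelianVariety.prodLift_snd, sub_hhh, MonObj.comp_mul, GrpObj.comp_inv, hγW, comp_hhh, ← Category.assoc,
      add_hhh, nsmul_hhh, MonObj.comp_mul, MonObj.comp_pow, hcW, hbW,
      show x₁ * x₂⁻¹ * x₂ ^ 2 = x₁ * x₂ by rw [sq, ← mul_assoc, inv_mul_cancel_right], mul_inv_cancel]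
  -- conclude: every coordinate of `π′(Ω⁻¹(P))` is trivial
  refine eq_one_of_comp_fst_snd _ (eq_one_of_comp_fst_snd _ ?_ ?_) ?_
  · rw [Category.assoc, Category.assoc, ← comp_hhh, ← comp_hhh, Category.assoc, AbelianVariety.prodMap_fst_assoc,
      AbelianVariety.prodMap_fst, ← Category.assoc (AbelianVariety.fst _ _), ← Category.assoc (untwistInv A hΘ hK j), comp_hhh,
      ← Category.assoc, ha, AbelianVariety.comp_torsionQuotHom_eq_one _ hn G₁ hG₁ hx₁]
  · rw [Category.assoc, Category.assoc, ← comp_hhh, ← comp_hhh, Category.assoc, AbelianVariety.prodMap_fst_assoc,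
      AbelianVariety.prodMap_snd, ← Category.assoc (AbelianVariety.fst _ _), ← Category.assoc (untwistInv A hΘ hK j), comp_hhh,
      ← Category.assoc, hb₂, AbelianVariety.comp_torsionQuotHom_eq_one _ hn G₂ hG₂ hx₂]
  · rw [Category.assoc, ← comp_hhh, Category.assoc, AbelianVariety.prodMap_snd, Category.comp_id, hβ]

/-- **`ε : Y × A → (A/G₁ × A/G₂) × Â`** — the factorisation of `Ω⁻¹ ≫ π′` through the isogeny `q × 1_A` (a CHOSEN
homomorphism; `IsIsogeny.exists_comp_eq_of_kerPoints_le_points` on complex points). [cite: MilneAV2008, I §8 Rem. 8.12 (p. 39)]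
[cite: Markman2025SecantWeil, §9.3 Remark 9.3.7 (p. 73)] -/
def descentFactor {j : ℕ} (hj : 2 * j + 1 = n) :
    (secantQuotient A hΘ G₁ G₂ hn hG₁ hG₂).prod A ⟶
      ((A.torsionQuot hn G₁ hG₁).prod (A.torsionQuot hn G₂ hG₂)).prod (A.dualOf Θ hΘ) :=
  ((AbelianVariety.isIsogeny_prodMap (isIsogeny_secantQuotientMap A hΘ G₁ G₂ hn hG₁ hG₂)
      (AbelianVariety.isIsogeny_id A)).exists_comp_eq_of_kerPoints_le_points ℂ _
    (kerPoints_prodMap_secantQuotientMap_le A hΘ hK hn G₁ G₂ hG₁ hG₂ hj)).choose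

/-- `(q × 1_A) ≫ ε = Ω⁻¹ ≫ π′`. [cite: MilneAV2008, I §8 Rem. 8.12 (p. 39)] -/
theorem prodMap_comp_descentFactor {j : ℕ} (hj : 2 * j + 1 = n) :
    AbelianVariety.prodMap (secantQuotientMap A hΘ G₁ G₂ hn hG₁ hG₂) (𝟙 A) ≫ descentFactor A hΘ hK hn G₁ G₂ hG₁ hG₂ hj =
      untwistInv A hΘ hK j ≫ AbelianVariety.prodMap
        (AbelianVariety.prodMap (A.torsionQuotHom hn G₁ hG₁) (A.torsionQuotHom hn G₂ hG₂)) (𝟙 (A.dualOf Θ hΘ)) :=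
  ((AbelianVariety.isIsogeny_prodMap (isIsogeny_secantQuotientMap A hΘ G₁ G₂ hn hG₁ hG₂)
      (AbelianVariety.isIsogeny_id A)).exists_comp_eq_of_kerPoints_le_points ℂ _
    (kerPoints_prodMap_secantQuotientMap_le A hΘ hK hn G₁ G₂ hG₁ hG₂ hj)).choose_spec

/-- **`π″ ≫ ε = π′ = (π₁ × π₂) × 1_Â`.** [cite: Markman2025SecantWeil, §9.3 Remark 9.3.7 (p. 73)] -/
theorem quotientProductHom_comp_descentFactor {j : ℕ} (hj : 2 * j + 1 = n) :
    quotientProductHom A hΘ hK hn G₁ G₂ hG₁ hG₂ j ≫ descentFactor A hΘ hK hn G₁ G₂ hG₁ hG₂ hj =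
      AbelianVariety.prodMap (AbelianVariety.prodMap (A.torsionQuotHom hn G₁ hG₁) (A.torsionQuotHom hn G₂ hG₂))
        (𝟙 (A.dualOf Θ hΘ)) := by
  rw [quotientProductHom, Category.assoc, prodMap_comp_descentFactor, ← Category.assoc, untwistHom_comp_untwistInv,
    Category.id_comp]

/-- The underlying morphism of `(π₁ × π₂) × 1_Â` is `quotientSpanProjection` of `MarkmanKernelDescent`. [cite: MumfordAV1970, §19] -/
theorem prodMap_prodMap_torsionQuotHom_hom :
    (AbelianVariety.prodMap (AbelianVariety.prodMap (A.torsionQuotHom hn G₁ hG₁) (A.torsionQuotHom hn G₂ hG₂))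
        (𝟙 (A.dualOf Θ hΘ))).hom.hom.hom =
      quotientSpanProjection A hΘ hn G₁ G₂ hG₁ hG₂ := by
  have h12 : (AbelianVariety.prodMap (A.torsionQuotHom hn G₁ hG₁) (A.torsionQuotHom hn G₂ hG₂)).hom.hom.hom =
      (A.torsionQuotHom hn G₁ hG₁).hom.hom.hom ⊗ₘ (A.torsionQuotHom hn G₂ hG₂).hom.hom.hom := by
    have e₁ := congrArg (fun φ => φ.hom.hom.hom) (AbelianVariety.prodMap_fst (A.torsionQuotHom hn G₁ hG₁) (A.torsionQuotHom hn G₂ hG₂))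
    have e₂ := congrArg (fun φ => φ.hom.hom.hom) (AbelianVariety.prodMap_snd (A.torsionQuotHom hn G₁ hG₁) (A.torsionQuotHom hn G₂ hG₂))
    simp only [comp_hhh, fst_hhh, snd_hhh] at e₁ e₂
    exact CartesianMonoidalCategory.hom_ext _ _ (by rw [tensorHom_fst, e₁]) (by rw [tensorHom_snd, e₂])
  have e₁ := congrArg (fun φ => φ.hom.hom.hom) (AbelianVariety.prodMap_fst
    (AbelianVariety.prodMap (A.torsionQuotHom hn G₁ hG₁) (A.torsionQuotHom hn G₂ hG₂)) (𝟙 (A.dualOf Θ hΘ)))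
  have e₂ := congrArg (fun φ => φ.hom.hom.hom) (AbelianVariety.prodMap_snd
    (AbelianVariety.prodMap (A.torsionQuotHom hn G₁ hG₁) (A.torsionQuotHom hn G₂ hG₂)) (𝟙 (A.dualOf Θ hΘ)))
  rw [Category.comp_id] at e₂
  simp only [comp_hhh, fst_hhh, snd_hhh, h12] at e₁ e₂
  refine CartesianMonoidalCategory.hom_ext _ _ ?_ ?_
  · rw [quotientSpanProjection, whiskerRight_fst]
    exact e₁
  · rw [quotientSpanProjection,
      show ((A.torsionQuotHom hn G₁ hG₁).hom.hom.hom ⊗ₘ (A.torsionQuotHom hn G₂ hG₂).hom.hom.hom) ▷ (A.dualOf Θ hΘ).X ≫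
          snd ((A.torsionQuot hn G₁ hG₁).prod (A.torsionQuot hn G₂ hG₂)).X (A.dualOf Θ hΘ).X =
        snd (A.prod A).X (A.dualOf Θ hΘ).X from whiskerRight_snd _ _]
    exact e₂

/-- `π″ ≫ ε = π′` on underlying schemes. [cite: Markman2025SecantWeil, §9.3 Remark 9.3.7 (p. 73)] -/
theorem toSchemeHom_quotientProductHom_comp_descentFactor {j : ℕ} (hj : 2 * j + 1 = n) :
    AbelianVariety.Hom.toSchemeHom (quotientProductHom A hΘ hK hn G₁ G₂ hG₁ hG₂ j) ≫
        AbelianVariety.Hom.toSchemeHom (descentFactor A hΘ hK hn G₁ G₂ hG₁ hG₂ hj) =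
      (quotientSpanProjection A hΘ hn G₁ G₂ hG₁ hG₂).left := by
  rw [← prodMap_prodMap_torsionQuotHom_hom, ← quotientProductHom_comp_descentFactor A hΘ hK hn G₁ G₂ hG₁ hG₂ hj]
  rfl

end Factor

/-! ### §2 The kernel descent transported to the cartesian square -/

section Transport

variable (hK : A.KTheta Θ = ⊥) {n : ℕ} (hn : n ≠ 0) (G₁ G₂ : Subgroup (A.Points ℂ))
  (hG₁ : G₁ ≤ A.torsionPoints ℂ n) (hG₂ : G₂ ≤ A.torsionPoints ℂ n)

/-- **KERNEL DESCENT ALONG THE CARTESIAN SQUARE: `π″^*(ε^*𝒩₀) ≅ 𝒩 ⊗ g′^*D′_s`** — the twisted span kernel of Markman's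
`Φ̃`, multiplied by `g′^*D′_s`, is pulled back along `π″ : (A × A) × Â → Y × A` (a base change of the quotient isogeny `q`)
from the EXPLICIT line bundle `ε^*𝒩₀` on `Y × A`; with `isPullback_kernelSpanMap_quotientProduct` this is the input of
the flat base change computing `q^*` of the descended transform. Hypotheses as in `MarkmanKernelDescentIdentity`.
[cite: Markman2025SecantWeil, §9.3 Lemma 9.3.5 and Remark 9.3.7 (pp. 71–73)] [cite: MumfordAV1970, §7 Thm. 4 (p. 72) and §23] -/
theorem nonempty_pullback_quotientProduct_markmanKernel_iso {s j m₁ m₂ : ℕ} (hj : 2 * j + 1 = n)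
    (hm₁ : n * m₁ = 2 * s + j + 1) (hm₂ : n * m₂ + j = 2 * s) (hc₁ : Nat.card G₁ = n) (hc₂ : Nat.card G₂ = n) :
    Nonempty ((Scheme.Modules.pullback (AbelianVariety.Hom.toSchemeHom (quotientProductHom A hΘ hK hn G₁ G₂ hG₁ hG₂ j))).obj
        ((Scheme.Modules.pullback (AbelianVariety.Hom.toSchemeHom (descentFactor A hΘ hK hn G₁ G₂ hG₁ hG₂ hj))).obj
          (markmanDescendedKernel A hΘ hK hn G₁ G₂ hG₁ hG₂ s m₁ m₂)) ≅
      tensorObj (markmanTwistedKernel A hΘ hK)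
        ((Scheme.Modules.pullback (kernelSpanMap A hΘ).left).obj (descentTwist A hΘ hK s j))) := by
  obtain ⟨e⟩ := nonempty_pullback_markmanDescendedKernel_iso A hΘ hK hn G₁ G₂ hG₁ hG₂ hj hm₁ hm₂ hc₁ hc₂
  exact ⟨(pullbackComp _ _).app _ ≪≫
    (pullbackCongr (toSchemeHom_quotientProductHom_comp_descentFactor A hΘ hK hn G₁ G₂ hG₁ hG₂ hj)).app _ ≪≫ e⟩

end Transport


end Literature.AlgebraicGeometry.AbelianVarieties

end
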